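import Mathlib
import Summits.AtomisticToContinuum.Crystallization.Theses.PhononSlackCertificates
import Summits.AtomisticToContinuum.Crystallization.Theorems.PhononSlackCertificatesNearFarGlueRLooseExhaustion
import Summits.AtomisticToContinuum.Crystallization.Theorems.NearFarGlueR.Negative.GlueToolkit
import Literature.MathematicalPhysics.StatisticalMechanics.LennardJonesClusters

/-!
# Crux `PhononSlackCertificates.NearFarGlueR` (stmt-AtomisticToContinuum-14970), line `Sketch`:
the MOVE step — relocating one particle to a better site

Continuation lead c4, part 3d (registered sub-goal `stub_moveStep`).  The third monotone operation
on a finite configuration, after STRIP (c3/c4) and FILL (c4): MOVE particle `j` to a point `p` at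
distance `≥ 3/10` from every other particle where it binds more strongly by `g'` —
`W_p(x ∖ j) = Σ_{k ≠ j} V(|p − x_k|) ≤ B_j(x) − g'`, `B_j(x) = Σ_{k ≠ j} V(|x_j − x_k|)` the bond
sum of `j`.  This is the pure move principle (`N·e* ≤ 𝓔(x')` for the moved configuration), so NO
bound on `e*` enters.  Proved here:

* `move_sep`: the moved configuration `Function.update x j p` is again `3/10`-separated;
* `move_energy`: the excess drops by `g'` — `[𝓔(x') − N·e*] + g' ≤ 𝓔(x) − N·e*`
  (`sum_siteEnergy_update_sub`);
* `card_contact_le_move`: `#T(x) ≤ 11664 + #T(x')` (a contact within `51/20` of `x_j` or of `p` is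
  one of `≤ 2·18³`; any other keeps its `3/2`-neighbourhood and its good partner's, through the
  common sub-configuration `x ∖ j = x' ∖ j`);
* `card_bad_le_move`: `#bad(x) ≤ 2662 + #bad(x')`.

What it buys (part 3e, `…NearFarGlueRStableCore`): cores may in addition be taken MOVE-STABLE —
no particle gains `g'` by a single relocation — which is how displaced particles ("rattlers",
`|u| > a/20` in an otherwise exact cage, cost `≈ ½κu² ≈ 0.05`) leave the residual: the short hop
back to the cage centre is a move to a site too close to `x_j` to count as a hole of `x`, but
admissible for `x ∖ j`.  All `[folklore]`.
-/

noncomputable section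

namespace Summit.AtomisticToContinuum.Crystallization.Theorems.PhononSlackCertificatesNearFarGlueR

open Literature.MathematicalPhysics.StatisticalMechanics
open Literature.Geometry.DiscreteGeometry
open Summit.AtomisticToContinuum.Crystallization.Theses.PhononSlackCertificates
open Summit.AtomisticToContinuum.Crystallization.Theorems.NearFarGlueRNegative (good_of_good_comp)
open scoped BigOperators

/-! ## §1 Separation and energy under a move -/

/-- Moving particle `j` to a point at distance `≥ 3/10` from every other particle keeps
`3/10`-separation. [folklore] -/
theorem move_sep {N : ℕ} (x : Fin N → EuclideanSpace ℝ (Fin 3))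
    (hsep : ∀ i k : Fin N, i ≠ k → (3 / 10 : ℝ) ≤ dist (x i) (x k)) (j : Fin N)
    (p : EuclideanSpace ℝ (Fin 3)) (hp : ∀ k : Fin N, k ≠ j → (3 / 10 : ℝ) ≤ dist p (x k)) :
    ∀ i k : Fin N, i ≠ k →
      (3 / 10 : ℝ) ≤ dist (Function.update x j p i) (Function.update x j p k) := by
  intro i k hik
  by_cases hi : i = j
  · subst hi
    have hk : k ≠ i := fun h => hik h.symm
    rw [Function.update_self, Function.update_of_ne hk]
    exact hp k hk
  · by_cases hk : k = j
    · subst hk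
      rw [Function.update_self, Function.update_of_ne hi, dist_comm]
      exact hp i hi
    · rw [Function.update_of_ne hi, Function.update_of_ne hk]
      exact hsep i k hik

/-- **A profitable move lowers the excess by `g'`** (pure move principle, no bound on `e*`): if
`Σ_{k ≠ j} V(|p − x_k|) ≤ Σ_{k ≠ j} V(|x_j − x_k|) − g'` then
`[𝓔(update x j p) − N·e*] + g' ≤ 𝓔(x) − N·e*`. [folklore] -/
theorem move_energy {N : ℕ} (x : Fin N → EuclideanSpace ℝ (Fin 3)) (j : Fin N)
    (p : EuclideanSpace ℝ (Fin 3)) {g' : ℝ}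
    (hgain : ∑ k ∈ Finset.univ.erase j, lennardJones (dist p (x k)) ≤
      ∑ k ∈ Finset.univ.erase j, lennardJones (dist (x j) (x k)) - g') :
    interactionEnergy lennardJones (Function.update x j p) -
        (N : ℝ) * (⨅ Q : PeriodicConfiguration 3, Q.energyPerParticle lennardJones) + g' ≤
      interactionEnergy lennardJones x -
        (N : ℝ) * (⨅ Q : PeriodicConfiguration 3, Q.energyPerParticle lennardJones) := by
  have hupd := sum_siteEnergy_update_sub lennardJones x j p
  have h2 := two_mul_interactionEnergy lennardJones x
  have h2' := two_mul_interactionEnergy lennardJones (Function.update x j p)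
  have hsite : siteEnergy lennardJones x j = ∑ k ∈ Finset.univ.erase j, lennardJones (dist (x j) (x k)) :=
    rfl
  rw [hsite] at hupd
  linarith

/-! ## §2 Counts under a move -/

/-- **Tight-contact count under a move**: for a `3/10`-separated `x`, `#T(x) ≤ 11664 + #T(x')` with
`x' = update x j p` — a contact of `x` lies within `51/20` of `x_j` or of `p` (at most `2·18³`), or it
and its good partner keep their `3/2`-neighbourhoods (`x ∖ j = x' ∖ j`). [folklore] -/
theorem card_contact_le_move {N : ℕ} (x : Fin N → EuclideanSpace ℝ (Fin 3))
    (hsep : ∀ i k : Fin N, i ≠ k → (3 / 10 : ℝ) ≤ dist (x i) (x k)) (j : Fin N)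
    (p : EuclideanSpace ℝ (Fin 3)) :
    (Nat.card {k : Fin N // ¬ IsTwoShellGood (1 / 20) (47 / 50) 1 x k ∧
        ∃ i : Fin N, IsTwoShellGood (1 / 20) (47 / 50) 1 x i ∧ dist (x i) (x k) ≤ 21 / 20} : ℝ) ≤
      11664 + (Nat.card {k : Fin N // ¬ IsTwoShellGood (1 / 20) (47 / 50) 1 (Function.update x j p) k ∧
        ∃ i : Fin N, IsTwoShellGood (1 / 20) (47 / 50) 1 (Function.update x j p) i ∧
          dist (Function.update x j p i) (Function.update x j p k) ≤ 21 / 20} : ℝ) := by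
  classical
  set y := Function.update x j p with hy
  -- the common sub-configuration off `j`
  set f := ((Finset.univ.erase j).orderEmbOfFin rfl).toEmbedding with hf
  have hfj : ∀ m, f m ≠ j := fun m => by
    have : f m ∈ Finset.univ.erase j := by
      rw [hf]; exact Finset.orderEmbOfFin_mem _ _ m
    exact Finset.ne_of_mem_erase this
  have hrange : ∀ w : Fin N, w ∉ Set.range f → w = j := by
    intro w hw
    by_contra hne
    have hmem : w ∈ Finset.univ.erase j := Finset.mem_erase.2 ⟨hne, Finset.mem_univ _⟩
    have : w ∈ Set.range ((Finset.univ.erase j).orderEmbOfFin rfl) := by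
      rw [Finset.range_orderEmbOfFin]; exact hmem
    obtain ⟨m, hm⟩ := this
    exact hw ⟨m, by rw [hf]; exact hm⟩
  have hyx : ∀ m, y (f m) = x (f m) := fun m => by rw [hy, Function.update_of_ne (hfj m)]
  have hcomp : y ∘ f = x ∘ f := funext hyx
  have hyj : y j = p := by rw [hy, Function.update_self]
  -- status is unchanged far from `x j` and `p`
  have hstat : ∀ k : Fin N, 3 / 2 < dist (x k) (x j) → 3 / 2 < dist (x k) p →
      (IsTwoShellGood (1 / 20) (47 / 50) 1 x k ↔ IsTwoShellGood (1 / 20) (47 / 50) 1 y k) := by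
    intro k hk1 hk2
    have hkj : k ≠ j := fun h => by rw [h, dist_self] at hk1; linarith
    obtain ⟨m, rfl⟩ : k ∈ Set.range f := by
      by_contra h; exact hkj (hrange k h)
    constructor
    · intro hg
      have h1 : IsTwoShellGood (1 / 20) (47 / 50) 1 (x ∘ f) m :=
        good_comp_of_good_far x f m (fun w hw => by rw [hrange w hw, dist_comm]; exact hk1) hg
      rw [← hcomp] at h1
      exact good_of_good_comp y f m (fun w hw => by rw [hrange w hw, hyj, hyx, dist_comm]; exact hk2) h1
    · intro hg
      have h1 : IsTwoShellGood (1 / 20) (47 / 50) 1 (y ∘ f) m :=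
        good_comp_of_good_far y f m (fun w hw => by rw [hrange w hw, hyj, hyx, dist_comm]; exact hk2) hg
      rw [hcomp] at h1
      exact good_of_good_comp x f m (fun w hw => by rw [hrange w hw, dist_comm]; exact hk1) h1
  set Tx := Finset.univ.filter fun k : Fin N => ¬ IsTwoShellGood (1 / 20) (47 / 50) 1 x k ∧
      ∃ i : Fin N, IsTwoShellGood (1 / 20) (47 / 50) 1 x i ∧ dist (x i) (x k) ≤ 21 / 20 with hTx
  set Ty := Finset.univ.filter fun k : Fin N => ¬ IsTwoShellGood (1 / 20) (47 / 50) 1 y k ∧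
      ∃ i : Fin N, IsTwoShellGood (1 / 20) (47 / 50) 1 y i ∧ dist (y i) (y k) ≤ 21 / 20 with hTy
  set S₁ := Finset.univ.filter fun k : Fin N => dist (x k) (x j) ≤ 51 / 20 with hS₁
  set S₂ := Finset.univ.filter fun k : Fin N => dist (x k) p ≤ 51 / 20 with hS₂
  rw [Nat.card_eq_fintype_card, Fintype.card_subtype, Nat.card_eq_fintype_card, Fintype.card_subtype]
  change ((Tx.card : ℕ) : ℝ) ≤ 11664 + ((Ty.card : ℕ) : ℝ)
  have hball : ∀ (q : EuclideanSpace ℝ (Fin 3)),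
      (((Finset.univ.filter fun k : Fin N => dist (x k) q ≤ 51 / 20).card : ℕ) : ℝ) ≤ 5832 := by
    intro q
    set S := Finset.univ.filter fun k : Fin N => dist (x k) q ≤ 51 / 20 with hS
    have hinj : Set.InjOn x S := fun a _ b _ hab => by
      by_contra hne
      have := hsep a b hne
      rw [hab, dist_self] at this
      exact absurd this (by norm_num)
    rw [← Finset.card_image_of_injOn hinj]
    have h := card_le_of_separated_of_dist_le (S.image x) q (by norm_num : (0 : ℝ) < 3 / 10)
      (by norm_num : (0 : ℝ) ≤ 51 / 20) ?_ ?_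
    · rw [finrank_euclideanSpace_fin] at h
      have h18 : (2 * (51 / 20 : ℝ) / (3 / 10) + 1) ^ 3 = 5832 := by norm_num
      rw [h18] at h
      exact h
    · intro c hc
      obtain ⟨k, hk, rfl⟩ := Finset.mem_image.1 hc
      exact (Finset.mem_filter.1 hk).2
    · intro c hc c' hc' hne
      obtain ⟨a, -, rfl⟩ := Finset.mem_image.1 hc
      obtain ⟨b, -, rfl⟩ := Finset.mem_image.1 hc'
      exact hsep a b fun h => hne (h ▸ rfl)
  have hS₁le : (S₁.card : ℝ) ≤ 5832 := hball (x j)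
  have hS₂le : (S₂.card : ℝ) ≤ 5832 := hball p
  have hmap : ∀ k ∈ Tx, k ∉ S₁ ∪ S₂ → k ∈ Ty := by
    intro k hk hkS
    obtain ⟨hbad, i, hgood, hd⟩ := (Finset.mem_filter.1 hk).2
    rw [Finset.mem_union, not_or] at hkS
    have hk1 : 51 / 20 < dist (x k) (x j) := by
      by_contra h; exact hkS.1 (Finset.mem_filter.2 ⟨Finset.mem_univ _, not_lt.1 h⟩)
    have hk2 : 51 / 20 < dist (x k) p := by
      by_contra h; exact hkS.2 (Finset.mem_filter.2 ⟨Finset.mem_univ _, not_lt.1 h⟩)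
    have hi1 : 3 / 2 < dist (x i) (x j) := by
      have := dist_triangle (x k) (x i) (x j); rw [dist_comm (x k) (x i)] at this; linarith
    have hi2 : 3 / 2 < dist (x i) p := by
      have := dist_triangle (x k) (x i) p; rw [dist_comm (x k) (x i)] at this; linarith
    have hkj : k ≠ j := fun h => by rw [h, dist_self] at hk1; linarith
    have hij : i ≠ j := fun h => by rw [h, dist_self] at hi1; linarith
    refine Finset.mem_filter.2 ⟨Finset.mem_univ _, fun hg => hbad ((hstat k (by linarith) (by linarith)).2 hg),
      i, (hstat i hi1 hi2).1 hgood, ?_⟩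
    rw [hy, Function.update_of_ne hij, Function.update_of_ne hkj]
    exact hd
  have h1 : Tx.card ≤ (S₁ ∪ S₂).card + (Tx.filter fun k => k ∉ S₁ ∪ S₂).card := by
    have hsplit := Finset.card_filter_add_card_filter_not (s := Tx) (fun k => k ∈ S₁ ∪ S₂)
    have hle : (Tx.filter fun k => k ∈ S₁ ∪ S₂).card ≤ (S₁ ∪ S₂).card :=
      Finset.card_le_card fun k hk => (Finset.mem_filter.1 hk).2
    omega
  have h2 : (Tx.filter fun k => k ∉ S₁ ∪ S₂).card ≤ Ty.card :=
    Finset.card_le_card fun k hk => hmap k (Finset.mem_filter.1 hk).1 (Finset.mem_filter.1 hk).2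
  have h3 : (S₁ ∪ S₂).card ≤ S₁.card + S₂.card := Finset.card_union_le _ _
  have h4 : (Tx.card : ℝ) ≤ S₁.card + S₂.card + Ty.card := by
    have : Tx.card ≤ S₁.card + S₂.card + Ty.card := by omega
    exact_mod_cast this
  linarith

/-- **Bad count under a move**: `#bad(x) ≤ 2662 + #bad(update x j p)` for a `3/10`-separated `x`
(a bad particle within `3/2` of `x_j` or of `p` is one of `≤ 2·11³`; any other stays bad).
[folklore] -/
theorem card_bad_le_move {N : ℕ} (x : Fin N → EuclideanSpace ℝ (Fin 3))
    (hsep : ∀ i k : Fin N, i ≠ k → (3 / 10 : ℝ) ≤ dist (x i) (x k)) (j : Fin N)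
    (p : EuclideanSpace ℝ (Fin 3)) :
    (Nat.card {k : Fin N // ¬ IsTwoShellGood (1 / 20) (47 / 50) 1 x k} : ℝ) ≤
      2662 + (Nat.card {k : Fin N // ¬ IsTwoShellGood (1 / 20) (47 / 50) 1 (Function.update x j p) k} : ℝ) := by
  classical
  set y := Function.update x j p with hy
  set f := ((Finset.univ.erase j).orderEmbOfFin rfl).toEmbedding with hf
  have hfj : ∀ m, f m ≠ j := fun m => by
    have : f m ∈ Finset.univ.erase j := by
      rw [hf]; exact Finset.orderEmbOfFin_mem _ _ m
    exact Finset.ne_of_mem_erase this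
  have hrange : ∀ w : Fin N, w ∉ Set.range f → w = j := by
    intro w hw
    by_contra hne
    have hmem : w ∈ Finset.univ.erase j := Finset.mem_erase.2 ⟨hne, Finset.mem_univ _⟩
    have : w ∈ Set.range ((Finset.univ.erase j).orderEmbOfFin rfl) := by
      rw [Finset.range_orderEmbOfFin]; exact hmem
    obtain ⟨m, hm⟩ := this
    exact hw ⟨m, by rw [hf]; exact hm⟩
  have hyx : ∀ m, y (f m) = x (f m) := fun m => by rw [hy, Function.update_of_ne (hfj m)]
  have hcomp : y ∘ f = x ∘ f := funext hyx
  have hyj : y j = p := by rw [hy, Function.update_self]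
  have hstat : ∀ k : Fin N, 3 / 2 < dist (x k) (x j) → 3 / 2 < dist (x k) p →
      IsTwoShellGood (1 / 20) (47 / 50) 1 y k → IsTwoShellGood (1 / 20) (47 / 50) 1 x k := by
    intro k hk1 hk2 hg
    have hkj : k ≠ j := fun h => by rw [h, dist_self] at hk1; linarith
    obtain ⟨m, rfl⟩ : k ∈ Set.range f := by
      by_contra h; exact hkj (hrange k h)
    have h1 : IsTwoShellGood (1 / 20) (47 / 50) 1 (y ∘ f) m :=
      good_comp_of_good_far y f m (fun w hw => by rw [hrange w hw, hyj, hyx, dist_comm]; exact hk2) hg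
    rw [hcomp] at h1
    exact good_of_good_comp x f m (fun w hw => by rw [hrange w hw, dist_comm]; exact hk1) h1
  set Bx := Finset.univ.filter fun k : Fin N => ¬ IsTwoShellGood (1 / 20) (47 / 50) 1 x k with hBx
  set By := Finset.univ.filter fun k : Fin N => ¬ IsTwoShellGood (1 / 20) (47 / 50) 1 y k with hBy
  set S₁ := Finset.univ.filter fun k : Fin N => dist (x k) (x j) ≤ 3 / 2 with hS₁
  set S₂ := Finset.univ.filter fun k : Fin N => dist (x k) p ≤ 3 / 2 with hS₂
  rw [Nat.card_eq_fintype_card, Fintype.card_subtype, Nat.card_eq_fintype_card, Fintype.card_subtype]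
  change ((Bx.card : ℕ) : ℝ) ≤ 2662 + ((By.card : ℕ) : ℝ)
  have hball : ∀ (q : EuclideanSpace ℝ (Fin 3)),
      (((Finset.univ.filter fun k : Fin N => dist (x k) q ≤ 3 / 2).card : ℕ) : ℝ) ≤ 1331 := by
    intro q
    set S := Finset.univ.filter fun k : Fin N => dist (x k) q ≤ 3 / 2 with hS
    have hinj : Set.InjOn x S := fun a _ b _ hab => by
      by_contra hne
      have := hsep a b hne
      rw [hab, dist_self] at this
      exact absurd this (by norm_num)
    rw [← Finset.card_image_of_injOn hinj]
    have h := card_le_of_separated_of_dist_le (S.image x) q (by norm_num : (0 : ℝ) < 3 / 10)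
      (by norm_num : (0 : ℝ) ≤ 3 / 2) ?_ ?_
    · rw [finrank_euclideanSpace_fin] at h
      have h11 : (2 * (3 / 2 : ℝ) / (3 / 10) + 1) ^ 3 = 1331 := by norm_num
      rw [h11] at h
      exact h
    · intro c hc
      obtain ⟨k, hk, rfl⟩ := Finset.mem_image.1 hc
      exact (Finset.mem_filter.1 hk).2
    · intro c hc c' hc' hne
      obtain ⟨a, -, rfl⟩ := Finset.mem_image.1 hc
      obtain ⟨b, -, rfl⟩ := Finset.mem_image.1 hc'
      exact hsep a b fun h => hne (h ▸ rfl)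
  have hS₁le : (S₁.card : ℝ) ≤ 1331 := hball (x j)
  have hS₂le : (S₂.card : ℝ) ≤ 1331 := hball p
  have hmap : ∀ k ∈ Bx, k ∉ S₁ ∪ S₂ → k ∈ By := by
    intro k hk hkS
    have hbad := (Finset.mem_filter.1 hk).2
    rw [Finset.mem_union, not_or] at hkS
    have hk1 : 3 / 2 < dist (x k) (x j) := by
      by_contra h; exact hkS.1 (Finset.mem_filter.2 ⟨Finset.mem_univ _, not_lt.1 h⟩)
    have hk2 : 3 / 2 < dist (x k) p := by
      by_contra h; exact hkS.2 (Finset.mem_filter.2 ⟨Finset.mem_univ _, not_lt.1 h⟩)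
    exact Finset.mem_filter.2 ⟨Finset.mem_univ _, fun hg => hbad (hstat k hk1 hk2 hg)⟩
  have h1 : Bx.card ≤ (S₁ ∪ S₂).card + (Bx.filter fun k => k ∉ S₁ ∪ S₂).card := by
    have hsplit := Finset.card_filter_add_card_filter_not (s := Bx) (fun k => k ∈ S₁ ∪ S₂)
    have hle : (Bx.filter fun k => k ∈ S₁ ∪ S₂).card ≤ (S₁ ∪ S₂).card :=
      Finset.card_le_card fun k hk => (Finset.mem_filter.1 hk).2
    omega
  have h2 : (Bx.filter fun k => k ∉ S₁ ∪ S₂).card ≤ By.card :=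
    Finset.card_le_card fun k hk => hmap k (Finset.mem_filter.1 hk).1 (Finset.mem_filter.1 hk).2
  have h3 : (S₁ ∪ S₂).card ≤ S₁.card + S₂.card := Finset.card_union_le _ _
  have h4 : (Bx.card : ℝ) ≤ S₁.card + S₂.card + By.card := by
    have : Bx.card ≤ S₁.card + S₂.card + By.card := by omega
    exact_mod_cast this
  linarith

/-- **Registered sub-goal `stub_moveStep` of the crux item** (skeleton `Lines/Sketch.lean`, c4):
a profitable single-particle move lowers the excess by its gain — the statement of `move_energy`
in closed form. [folklore] -/
theorem stub_moveStep :
    ∀ (N : ℕ) (x : Fin N → EuclideanSpace ℝ (Fin 3)) (j : Fin N) (p : EuclideanSpace ℝ (Fin 3)) (g' : ℝ),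
      ∑ k ∈ Finset.univ.erase j, lennardJones (dist p (x k)) ≤
        ∑ k ∈ Finset.univ.erase j, lennardJones (dist (x j) (x k)) - g' →
      interactionEnergy lennardJones (Function.update x j p) -
          (N : ℝ) * (⨅ Q : PeriodicConfiguration 3, Q.energyPerParticle lennardJones) + g' ≤
        interactionEnergy lennardJones x -
          (N : ℝ) * (⨅ Q : PeriodicConfiguration 3, Q.energyPerParticle lennardJones) :=
  fun _ x j p _ hgain => move_energy x j p hgain

end Summit.AtomisticToContinuum.Crystallization.Theorems.PhononSlackCertificatesNearFarGlueR

end
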